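import Literature.NumberTheory.GelbartRogawski1991.LocalLineIsometryNaturality
import Literature.NumberTheory.GelbartRogawski1991.LocalLineIsometryUndoubling
import HarnessLib

/-!
# S6a, hypothesis-free: naturality of the CM local splitting under the local isometry of two lines, at every finite place

Topic `NumberTheory/GelbartRogawski1991`; namespace `Literature.NumberTheory.GelbartRogawski1991.UnitaryDualPair.LocalSplitting`.
KERNEL ONLY: one theorem; no definition, no named fact, no `sorry`.  The two hypotheses `hΔ` (the doubled line isometry preserves
Kudla's Lagrangian `ℓ_Δ`) and `hD4` (undoubling commutes with the conjugation by a lift of it) of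
`lineTransportSplitting_lineTransportSection_congrW_undoubledSplittings` (`LocalLineIsometryNaturality`, cell hodgecm-mathlib line
a4-liuD3, step S6a) are DISCHARGED BY NAME from `LocalLineIsometryUndoubling` (`transport_deltaLagrangian`,
`undoubleLoc_conj_eq_lineTransportSplitting`): the line transport by `x` of the `χ`-attached local splitting on the line `a₁`
IS the `χ`-attached local splitting on the line `a₂`, at EVERY finite place of `L⁺` — the `hS6a i j` of the crux workfile
`Cruxes/HD3/Lines/a4_liuD3.lean` (stub `stub_lineRigidityS6a`) at `N = 3`, `L = F`, `χ = μ_i`, `a₁ = a_i`, `a₂ = a_j`, up to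
unfolding `OmegaChiSplitting.chiLocalSplittingsD`.

References: [Kudla1994] §3 Thm. 3.1; [GelbartRogawski1991] §3.1 Prop. 3.1.1, Remark p. 457; [MoeglinVignerasWaldspurger1987]
Chap. 2 II.1, Chap. 3 I.1–I.3; [HarrisKudlaSweet1996] §1 (1.11)–(1.16); [Liu2021] App. D Lem. D.1 (3) (l. 5233), proof l. 5249–5255.
-/

set_option autoImplicit false

noncomputable section

open scoped Matrix Kronecker
open NumberField IsDedekindDomain
open Literature.RepresentationTheory.HeisenbergGroup
open Literature.RepresentationTheory.MoeglinVignerasWaldspurger1987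
open Literature.NumberTheory.Automorphic Literature.NumberTheory.Automorphic.UnitaryGroup
open Literature.NumberTheory.Weil1964
open Literature.RepresentationTheory.HarrisKudlaSweet1996
open Literature.NumberTheory.GaloisRepresentations
open Literature.NumberTheory.Automorphic.Liu2021.Def411WeilCarriers (TW JW JW_eq isSymm_TW isUnit_det_TW)
open Literature.NumberTheory.Automorphic.Liu2021.Def411WeilCarriersDoubling (lineW complexConj_lineW lineW_ne_zero
  realDiagonal_lineW diagonal_lineW)

namespace Literature.NumberTheory.GelbartRogawski1991.UnitaryDualPair.LocalSplitting

open MeasureTheory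
open Literature.NumberTheory.GelbartRogawski1991.GRConstruction (Fp gramR gramR_isSymm isUnit_det_gramR₀ congrW undoubledSplittings
  cmFinLocalFamily borelPlaceMeasure)

variable (L : Type) [Field L] [NumberField L] [IsCMField L] {N : ℕ}
  (dV : Fin N → L) (hdV : ∀ i, IsCMField.complexConj L (dV i) = dV i) (hdV0 : ∀ i, dV i ≠ 0)
  (v : HeightOneSpectrum (𝓞 (Fp L)))

-- heartbeats: the statement alone (two transported CM packages spelled in full) exceeds the default budget, as for the
-- hypothesis-carrying version.
set_option maxHeartbeats 1600000 in
/-- **S6a, HYPOTHESIS-FREE, AT EVERY FINITE PLACE**: for a CM field `L`, a real frame `dV` (rank `N ≥ 1`), a splitting character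
`χ`, lines `a₁, a₂ ∈ L⁺ˣ`, a finite place `v` of `L⁺` and a unit `x` of `L ⊗ L⁺_v` with `a₂⁻¹δ = x xᶜ a₁⁻¹δ`, the line transport by
`x` of the model-transported `χ`-attached local splitting on the line `a₁` equals the model-transported `χ`-attached local
splitting on the line `a₂`. [cite: Kudla1994, §3 Thm 3.1] [cite: GelbartRogawski1991, §3.1 Remark p. 457 L4–13]
[cite: MoeglinVignerasWaldspurger1987, Chap. 3 I.1–I.3] [cite: Liu2021, App. D Lemma D.1 (3) (l. 5233), proof l. 5249–5255] -/
theorem lineTransportSplitting_lineTransportSection_congrW_undoubledSplittings_holds (hN : 0 < N)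
    (χ : HeckeCharacter L) (hχ : IsSplittingChar L 1 χ) (a₁ a₂ : (Fp L)ˣ) (x : (LocalRing L v)ˣ)
    (hx : algebraMap L (LocalRing L v) (algebraMap (Fp L) L (↑a₂⁻¹ : Fp L) * imagUnit L) =
      (x : LocalRing L v) * conjLocal L (IsCMField.complexConj L) v x *
        algebraMap L (LocalRing L v) (algebraMap (Fp L) L (↑a₁⁻¹ : Fp L) * imagUnit L)) :
    lineTransportSplitting L v (IsCMField.complexConj L) N (conj_lineDelta (complexConj_imagUnit L) a₁)
        (lineDelta_ne_zero (imagUnit_ne_zero L) a₁) (lineDelta_mul_self (imagUnit_mul_self L) a₁)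
        (conj_lineDelta (complexConj_imagUnit L) a₂) (lineDelta_ne_zero (imagUnit_ne_zero L) a₂)
        (lineDelta_mul_self (imagUnit_mul_self L) a₂) x (realDiagonal L dV hdV) (realDiagonal_isSymm L dV hdV)
        (isUnit_det_realDiagonal L dV hdV hdV0) hx
        (lineTransportSection (Fp L) L (IsCMField.complexConj L) N (complexConj_imagUnit L) (imagUnit_ne_zero L)
          (imagUnit_mul_self L) (realDiagonal L dV hdV) (realDiagonal_isSymm L dV hdV) (Matrix.diagonal dV)
          (realDiagonal_map L dV hdV).symm a₁ v
          ((congrW L (Equiv.prodUnique (Fin N) (Fin 1)) dV hdV (lineW L (TW (Fp L) a₁)) (complexConj_lineW L (TW (Fp L) a₁))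
            (realDiagonal_lineW L (TW (Fp L) a₁)) (diagonal_lineW L (TW (Fp L) a₁) (JW_eq (Fp L) L a₁))
            (undoubledSplittings L (Equiv.prodUnique (Fin N) (Fin 1)) dV hdV hdV0 (lineW L (TW (Fp L) a₁))
              (complexConj_lineW L (TW (Fp L) a₁)) (lineW_ne_zero L (TW (Fp L) a₁) (isUnit_det_TW (Fp L) a₁)) χ
              (borelPlaceMeasure L)
              (cmFinLocalFamily L (Equiv.prodUnique (Fin N) (Fin 1)) dV hdV hdV0 (lineW L (TW (Fp L) a₁))
                (complexConj_lineW L (TW (Fp L) a₁)) (lineW_ne_zero L (TW (Fp L) a₁) (isUnit_det_TW (Fp L) a₁)) χ hχ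
                (borelPlaceMeasure L)))
            (isSymm_TW (Fp L) a₁) (JW_eq (Fp L) L a₁)).s v)
          ((congrW L (Equiv.prodUnique (Fin N) (Fin 1)) dV hdV (lineW L (TW (Fp L) a₁)) (complexConj_lineW L (TW (Fp L) a₁))
            (realDiagonal_lineW L (TW (Fp L) a₁)) (diagonal_lineW L (TW (Fp L) a₁) (JW_eq (Fp L) L a₁))
            (undoubledSplittings L (Equiv.prodUnique (Fin N) (Fin 1)) dV hdV hdV0 (lineW L (TW (Fp L) a₁))
              (complexConj_lineW L (TW (Fp L) a₁)) (lineW_ne_zero L (TW (Fp L) a₁) (isUnit_det_TW (Fp L) a₁)) χ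
              (borelPlaceMeasure L)
              (cmFinLocalFamily L (Equiv.prodUnique (Fin N) (Fin 1)) dV hdV hdV0 (lineW L (TW (Fp L) a₁))
                (complexConj_lineW L (TW (Fp L) a₁)) (lineW_ne_zero L (TW (Fp L) a₁) (isUnit_det_TW (Fp L) a₁)) χ hχ
                (borelPlaceMeasure L)))
            (isSymm_TW (Fp L) a₁) (JW_eq (Fp L) L a₁)).proj_s v)) =
      lineTransportSection (Fp L) L (IsCMField.complexConj L) N (complexConj_imagUnit L) (imagUnit_ne_zero L)
        (imagUnit_mul_self L) (realDiagonal L dV hdV) (realDiagonal_isSymm L dV hdV) (Matrix.diagonal dV)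
        (realDiagonal_map L dV hdV).symm a₂ v
        ((congrW L (Equiv.prodUnique (Fin N) (Fin 1)) dV hdV (lineW L (TW (Fp L) a₂)) (complexConj_lineW L (TW (Fp L) a₂))
          (realDiagonal_lineW L (TW (Fp L) a₂)) (diagonal_lineW L (TW (Fp L) a₂) (JW_eq (Fp L) L a₂))
          (undoubledSplittings L (Equiv.prodUnique (Fin N) (Fin 1)) dV hdV hdV0 (lineW L (TW (Fp L) a₂))
            (complexConj_lineW L (TW (Fp L) a₂)) (lineW_ne_zero L (TW (Fp L) a₂) (isUnit_det_TW (Fp L) a₂)) χ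
            (borelPlaceMeasure L)
            (cmFinLocalFamily L (Equiv.prodUnique (Fin N) (Fin 1)) dV hdV hdV0 (lineW L (TW (Fp L) a₂))
              (complexConj_lineW L (TW (Fp L) a₂)) (lineW_ne_zero L (TW (Fp L) a₂) (isUnit_det_TW (Fp L) a₂)) χ hχ
              (borelPlaceMeasure L)))
          (isSymm_TW (Fp L) a₂) (JW_eq (Fp L) L a₂)).s v)
        ((congrW L (Equiv.prodUnique (Fin N) (Fin 1)) dV hdV (lineW L (TW (Fp L) a₂)) (complexConj_lineW L (TW (Fp L) a₂))
          (realDiagonal_lineW L (TW (Fp L) a₂)) (diagonal_lineW L (TW (Fp L) a₂) (JW_eq (Fp L) L a₂))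
          (undoubledSplittings L (Equiv.prodUnique (Fin N) (Fin 1)) dV hdV hdV0 (lineW L (TW (Fp L) a₂))
            (complexConj_lineW L (TW (Fp L) a₂)) (lineW_ne_zero L (TW (Fp L) a₂) (isUnit_det_TW (Fp L) a₂)) χ
            (borelPlaceMeasure L)
            (cmFinLocalFamily L (Equiv.prodUnique (Fin N) (Fin 1)) dV hdV hdV0 (lineW L (TW (Fp L) a₂))
              (complexConj_lineW L (TW (Fp L) a₂)) (lineW_ne_zero L (TW (Fp L) a₂) (isUnit_det_TW (Fp L) a₂)) χ hχ
              (borelPlaceMeasure L)))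
          (isSymm_TW (Fp L) a₂) (JW_eq (Fp L) L a₂)).proj_s v) :=
  lineTransportSplitting_lineTransportSection_congrW_undoubledSplittings L dV hdV hdV0 v hN χ hχ a₁ a₂ x hx
    (transport_deltaLagrangian (Fp L) L (IsCMField.complexConj L) v (conj_lineDelta (complexConj_imagUnit L) a₁)
      (lineDelta_ne_zero (imagUnit_ne_zero L) a₁) (lineDelta_mul_self (imagUnit_mul_self L) a₁)
      (conj_lineDelta (complexConj_imagUnit L) a₂) (lineDelta_ne_zero (imagUnit_ne_zero L) a₂)
      (lineDelta_mul_self (imagUnit_mul_self L) a₂) x N (realDiagonal_isSymm L dV hdV) hx)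
    (fun S hS P hP hS' => undoubleLoc_conj_eq_lineTransportSplitting (Fp L) L (IsCMField.complexConj L) v
      (conj_lineDelta (complexConj_imagUnit L) a₁) (lineDelta_ne_zero (imagUnit_ne_zero L) a₁)
      (lineDelta_mul_self (imagUnit_mul_self L) a₁) (conj_lineDelta (complexConj_imagUnit L) a₂)
      (lineDelta_ne_zero (imagUnit_ne_zero L) a₂) (lineDelta_mul_self (imagUnit_mul_self L) a₂) x N
      (realDiagonal_map L dV hdV).symm rfl (realDiagonal_isSymm L dV hdV) (isUnit_det_realDiagonal L dV hdV hdV0) hx S hS P hP hS')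

end Literature.NumberTheory.GelbartRogawski1991.UnitaryDualPair.LocalSplitting

end
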